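import Summits.Ventures.WeilGRH.UniformConductorFloorMinorant
import HarnessLib

/-!
# GRH arm (rh-explicit, venture WeilGRH): the all-trivial-key minorant with Weil's full archimedean kernel (`M = ∞`)

Cell `rh-explicit`, WEIL TRACK — GRH ARM (weil-grh-1).  `UniformConductorFloorMinorant.lean` proves
`T_M(|g|) ≤ Re Q_χ(g)` for the pseudo-key form with `M` Lévy layers `e^{−2(m+x)|u|}`, `m < M`.  The layers are
non-negative and sum to Weil's kernel `J_x(u) = e^{−2x|u|}/(1 − e^{−2|u|})` (`levyDensity`), so by monotone
convergence (`integral_tsum_of_summable_integral_norm`; the partial sums are bounded by `Re Q_χ(g)`) the form with the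
FULL kernel,

  `T(h) = (log q − log π + ψ(x)) ∫h² + ∫ J_x(u) (∫h² − ∫ h(y)h(y−u) dy) du − Σ_{n≤N} (Λ(n)/√n)·2∫ h(y)h(y − log n) dy`

(`trivialKeyForm`, position space: Weil's (11) for the «character» `n ↦ 1` at conductor parameter `q`, archimedean
term in the Montgomery–Vaughan form (12.22)), satisfies **`T(|g|) ≤ Re Q_χ(g)`** (`re_weilQuadraticChar_ge_trivialKeyForm`)
and **pseudo-key positivity at `Q₀` ⇒ `WeilPositivityOnChar χ t` for every character of the parity and every modulus
`q ≥ Q₀`** (`weilPositivityOnChar_of_trivialKeyForm_nonneg`).  The cell's K(t)-closure certificates for the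
pseudo-keys (weil-grh-2: `Q₀ = 75` / odd `30` at `t = 1`, `29 / 14` at `4023/5000`, `18 / 9` at `log 2`, each exact)
are statements about exactly this form on the functions `|g|`.

## References

* A. Weil (1952), (11) with (5), (10) and the «lemme» p. 262 [Weil1952FormulesExplicites];
  H. L. Montgomery, R. C. Vaughan (2007), (12.22), Lemma 12.14 [MontgomeryVaughan2007].
-/

noncomputable section

open Complex Filter Set MeasureTheory
open scoped Real Topology ComplexConjugate ArithmeticFunction.vonMangoldt

namespace Summit.Ventures.WeilGRH

open Literature.NumberTheory.LFunctions

namespace UniformFloor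

variable {g : ℝ → ℂ}

/-- The **all-trivial-key form with Weil's full kernel** `J_x = levyDensity x` (the `M = ∞` case of
`trivialKeyFormTrunc`), for a real function `h`. [cite: Weil1952FormulesExplicites, (11) pp. 261–262 with every χ(n) replaced by 1; MontgomeryVaughan2007, (12.22)] -/
def trivialKeyForm (x : ℝ) (q N : ℕ) (h : ℝ → ℝ) : ℝ :=
  (Real.log q - Real.log π + (digamma (x : ℂ)).re) * (∫ y : ℝ, h y ^ 2) +
    (∫ u : ℝ, levyDensity x u * ((∫ y : ℝ, h y ^ 2) - ∫ y : ℝ, h y * h (y - u))) -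
    ∑ n ∈ Finset.range (N + 1), (Λ n : ℝ) / Real.sqrt n * (2 * ∫ y : ℝ, h y * h (y - Real.log n))

/-- The layers sum to Weil's kernel: `Σ_m e^{−2(m+x)|u|} F = J_x(u) F` whenever `F = 0` at `u = 0`
(geometric series for `u ≠ 0`). [folklore] -/
theorem hasSum_layers_mul (x : ℝ) {F : ℝ → ℝ} (hF0 : F 0 = 0) (u : ℝ) :
    HasSum (fun m : ℕ ↦ Real.exp (-(2 * ((m : ℝ) + x) * |u|)) * F u) (levyDensity x u * F u) := by
  by_cases hu : u = 0
  · subst hu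
    simp only [hF0, mul_zero]
    exact hasSum_zero
  have hpos : 0 < |u| := abs_pos.2 hu
  set r : ℝ := Real.exp (-(2 * |u|)) with hr
  have hr0 : 0 ≤ r := (Real.exp_pos _).le
  have hr1 : r < 1 := Real.exp_lt_one_iff.2 (by linarith)
  have hgeo := hasSum_geometric_of_lt_one hr0 hr1
  have e : ∀ m : ℕ, Real.exp (-(2 * ((m : ℝ) + x) * |u|)) = Real.exp (-(2 * x * |u|)) * r ^ m := by
    intro m
    rw [hr, ← Real.exp_nat_mul, ← Real.exp_add]
    ring_nf
  have h := (hgeo.mul_left (Real.exp (-(2 * x * |u|)))).mul_right (F u)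
  have hval : levyDensity x u * F u = Real.exp (-(2 * x * |u|)) * (1 - r)⁻¹ * F u := by
    unfold levyDensity
    rw [hr, div_eq_mul_inv]
  have hfun : (fun m : ℕ ↦ Real.exp (-(2 * ((m : ℝ) + x) * |u|)) * F u) =
      fun m : ℕ ↦ Real.exp (-(2 * x * |u|)) * r ^ m * F u := by
    funext m; rw [e m]
  rw [hval, hfun]
  exact h

/-- **THE MINORANT WITH THE FULL KERNEL**: `T(|g|) ≤ Re Q_χ(g)` for every Dirichlet character `χ` mod `q ≠ 1` of
parity `κ` (`x = ¼ + κ/2`), every test function `g` supported in `[-t, t]` and `e^{2t} ≤ N + 1`.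
[cite: Weil1952FormulesExplicites, (11) pp. 261–262 and the «lemme» p. 262] -/
theorem re_weilQuadraticChar_ge_trivialKeyForm {q : ℕ} (hq : q ≠ 1) (χ : DirichletCharacter ℂ q) {κ : ℕ}
    (hκ : charParity χ = κ) (hg : IsWeilTest g) {t : ℝ} (hsupp : tsupport g ⊆ Icc (-t) t) {N : ℕ}
    (hN : Real.exp (2 * t) ≤ (N : ℝ) + 1) :
    trivialKeyForm (1 / 4 + (κ : ℝ) / 2) q N (fun y ↦ ‖g y‖) ≤ (weilQuadraticChar χ g).re := by
  set x : ℝ := 1 / 4 + (κ : ℝ) / 2 with hx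
  have hx0 : 0 < x := by positivity
  set N2 : ℝ := ∫ y : ℝ, ‖g y‖ ^ 2 with hN2
  set F : ℝ → ℝ := fun u ↦ N2 - ∫ y : ℝ, ‖g y‖ * ‖g (y - u)‖ with hF
  set C : ℝ := (Real.log q - Real.log π + (digamma (x : ℂ)).re) * N2 with hC
  set P : ℝ := ∑ n ∈ Finset.range (N + 1), (Λ n : ℝ) / Real.sqrt n *
    (2 * ∫ y : ℝ, ‖g y‖ * ‖g (y - Real.log n)‖) with hP
  set a : ℕ → ℝ := fun m ↦ ∫ u : ℝ, Real.exp (-(2 * ((m : ℝ) + x) * |u|)) * F u with ha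
  -- the finite-layer theorem, read as a bound on the partial sums of `a`
  have hT : ∀ M : ℕ, C + ∑ m ∈ Finset.range M, a m - P ≤ (weilQuadraticChar χ g).re := fun M ↦ by
    have h := re_weilQuadraticChar_ge_trivialKeyFormTrunc hq χ hκ hg hsupp hN M
    simp only [trivialKeyFormTrunc] at h
    exact h
  -- the layers: nonnegative, integrable, with summable integrals
  have hF0 : F 0 = 0 := by
    simp only [hF, sub_zero, hN2]
    rw [sub_eq_zero]
    exact integral_congr_ae (Eventually.of_forall fun y ↦ by simp only; ring)
  have hFnn : ∀ u, 0 ≤ F u := fun u ↦ sub_nonneg.2 (integral_norm_mul_norm_shift_le hg u)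
  have hFle : ∀ u, F u ≤ N2 := fun u ↦ by
    simp only [hF]; linarith [integral_norm_mul_norm_shift_nonneg g u]
  have hFm : Measurable F := measurable_const.sub (stronglyMeasurable_integral_norm_mul_norm_shift hg).measurable
  have hEc : ∀ m : ℕ, Continuous fun u : ℝ ↦ Real.exp (-(2 * ((m : ℝ) + x) * |u|)) := fun m ↦
    Real.continuous_exp.comp ((continuous_const.mul continuous_abs).neg)
  have hfI : ∀ m : ℕ, Integrable fun u : ℝ ↦ Real.exp (-(2 * ((m : ℝ) + x) * |u|)) * F u := by
    intro m
    refine ((integrable_exp_neg_mul_abs (by positivity : 0 < 2 * ((m : ℝ) + x))).mul_const N2).mono'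
      ((hEc m).measurable.mul hFm).aestronglyMeasurable (Eventually.of_forall fun u ↦ ?_)
    rw [Real.norm_of_nonneg (mul_nonneg (Real.exp_pos _).le (hFnn u))]
    exact mul_le_mul_of_nonneg_left (hFle u) (Real.exp_pos _).le
  have hann : ∀ m, 0 ≤ a m := fun m ↦ integral_nonneg fun u ↦ mul_nonneg (Real.exp_pos _).le (hFnn u)
  have hbound : ∀ M, ∑ m ∈ Finset.range M, a m ≤ (weilQuadraticChar χ g).re - C + P := fun M ↦ by
    linarith [hT M]
  have hsum : Summable a := summable_of_sum_range_le hann hbound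
  have hnorm : ∀ m : ℕ, ∫ u : ℝ, ‖Real.exp (-(2 * ((m : ℝ) + x) * |u|)) * F u‖ = a m := fun m ↦
    integral_congr_ae (Eventually.of_forall fun u ↦ by
      simp only; rw [Real.norm_of_nonneg (mul_nonneg (Real.exp_pos _).le (hFnn u))])
  have hsum' : Summable fun m : ℕ ↦ ∫ u : ℝ, ‖Real.exp (-(2 * ((m : ℝ) + x) * |u|)) * F u‖ := by
    simp_rw [hnorm]; exact hsum
  -- exchange sum and integral; the pointwise sum is Weil's kernel times `F`
  have hx1 := integral_tsum_of_summable_integral_norm hfI hsum'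
  have hptw : ∀ u : ℝ, ∑' m : ℕ, Real.exp (-(2 * ((m : ℝ) + x) * |u|)) * F u = levyDensity x u * F u :=
    fun u ↦ (hasSum_layers_mul x hF0 u).tsum_eq
  simp_rw [hptw] at hx1
  -- hx1 : ∑' m, a m = ∫ u, J_x(u) F(u)
  have hlim : Tendsto (fun M : ℕ ↦ ∑ m ∈ Finset.range M, a m) atTop (𝓝 (∫ u : ℝ, levyDensity x u * F u)) := by
    rw [← hx1]
    exact hsum.hasSum.tendsto_sum_nat
  have hle : C + (∫ u : ℝ, levyDensity x u * F u) - P ≤ (weilQuadraticChar χ g).re := by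
    have hlim2 : Tendsto (fun M : ℕ ↦ C + ∑ m ∈ Finset.range M, a m - P) atTop
        (𝓝 (C + (∫ u : ℝ, levyDensity x u * F u) - P)) :=
      (tendsto_const_nhds.add hlim).sub tendsto_const_nhds
    exact le_of_tendsto' hlim2 hT
  simp only [trivialKeyForm]
  exact hle

/-- **FROM ONE PSEUDO-KEY TO EVERY CHARACTER (full kernel).**  If Weil's all-trivial-key form of parity `κ` and
conductor parameter `Q₀` is non-negative at `|g|` for every test function `g` supported in `[-t, t]`, then
`WeilPositivityOnChar χ t` for EVERY Dirichlet character of parity `κ` and EVERY modulus `q ≥ Q₀`.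
[cite: Weil1952FormulesExplicites, (11) and the «lemme» p. 262] -/
theorem weilPositivityOnChar_of_trivialKeyForm_nonneg {q : ℕ} (hq : q ≠ 1) (χ : DirichletCharacter ℂ q)
    {κ : ℕ} (hκ : charParity χ = κ) {t : ℝ} {N : ℕ} (hN : Real.exp (2 * t) ≤ (N : ℝ) + 1)
    {Q₀ : ℕ} (hQ₀ : 0 < Q₀) (hQ : Q₀ ≤ q)
    (hpos : ∀ g : ℝ → ℂ, IsWeilTest g → tsupport g ⊆ Icc (-t) t →
      0 ≤ trivialKeyForm (1 / 4 + (κ : ℝ) / 2) Q₀ N (fun y ↦ ‖g y‖)) :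
    WeilPositivityOnChar χ t := by
  intro g hg hsupp
  have h1 := re_weilQuadraticChar_ge_trivialKeyForm hq χ hκ hg hsupp hN
  have h2 := hpos g hg hsupp
  have hlog : Real.log Q₀ ≤ Real.log q :=
    Real.log_le_log (by exact_mod_cast hQ₀) (by exact_mod_cast hQ)
  have hN20 : 0 ≤ ∫ y : ℝ, ‖g y‖ ^ 2 := integral_nonneg fun _ ↦ by positivity
  have e : trivialKeyForm (1 / 4 + (κ : ℝ) / 2) q N (fun y ↦ ‖g y‖) =
      trivialKeyForm (1 / 4 + (κ : ℝ) / 2) Q₀ N (fun y ↦ ‖g y‖) +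
        (Real.log q - Real.log Q₀) * ∫ y : ℝ, ‖g y‖ ^ 2 := by
    unfold trivialKeyForm; ring
  rw [e] at h1
  nlinarith [mul_nonneg (sub_nonneg.2 hlog) hN20]

end UniformFloor

end Summit.Ventures.WeilGRH

end
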